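import Summits.QuantumFields.YangMills.Theorems.BalabanUVNodesN15SiteAveragingSpecies
import Summits.QuantumFields.YangMills.Theorems.BalabanUVNodesN15FullPropagatorC2BgSiteN15At
import Summits.QuantumFields.YangMills.Theorems.BalabanUVNodesN15SiteScalarLayerDressedF
import HarnessLib

/-!
# Route «BalabanUVNodes», cluster K4 «SpineRates» — node N15 = NE2: THE SITE LAYER WITH THE BACKGROUND LIVE IN THE TwoGrid ENTRY CURRENCY, XVII-b — PART XVII's LINEARISED
# AVERAGING SPECIES AT dag-n15-c's PRIMITIVE-CARRIER FAMILY (`fgInstanceC2`): the species read off the bond coefficient of the primitive pair, its six letters from `Reg335`,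
# part XIII's averaging-species binder `hF` LITERALLY inhabited for that family, and the three site letters of the family's FULL (3.65) perturbations (both species live)

Cell `pub-ymgap`, WIDTH SEAT `pub-ymgap-dag-n15-w1` (generation 3; director-ym №197 ∕ HUMAN RULING D-0149; chair R455 (A) ∕ R461; plan g83 `W-SEAT-START-LIST.md` v11 §n15).
`bears_on: R4∕N15 · K3⁷ SpineGivenEndpointR13SepCoPH (stmt-QuantumFields-20544)`.  Filed `--supports stmt-QuantumFields-20544 --as helper` — COUNT-NEUTRAL.  Six plumbing `def`s (the
species of the family, the two perturbation matrices), the rest theorems; 0 `sorry`.  Imports BY NAME, nothing in the tree modified: this seat's part XVII `…N15SiteAveragingSpecies` (§1 `siteAvgFc∕Fsc∕Ff∕Fsf`,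
`siteAvgSpecies_letters`) part X `…N15FullPropagatorC2BgSiteN15At` (through it `fgInstanceC2`, `pair_avg_eq`, FILE 10 `fibreOsc_of_fgrad`, n15-b `abs_blockAvg_le`, lit `fit_blockAvg`, `c2SiteSpeciesC∕F`,
`c2SiteSpecies_letters`, `FGIndexLM`) and part XIII `…N15SiteScalarLayerDressedF` (`siteLettersF_of_speciesLetters`; through it part VI `sitePert365F`).

WHY ∕ CONTENTS.  Part XIII's `hF` is stated for configurations of an abstract `B9.Backgrounds` family with block means `avg`; part X's family reads dag-n15-c's primitive coefficient pair
`U = (c′, a′)`.  §1: `c2AvgFc ∕ c2AvgFsc ∕ c2AvgFf ∕ c2AvgFsf` = part XVII §1 at `a′ := U.2`, `a := (avg U).2 = Ū.2`, component `ν = i.2` (+ `_eq`); `kav_nonneg`; ★★ `c2AvgSpecies_letters`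
(sizes `≤ diagK (K_av α₀)`, fits `≤ diagK (K_av α₀ (L^k)^{−γ∕2})`, every `γ ≤ 2`, every index and size: `|a′|, |Ū.2| ≤ c₃₅α₀`; pointwise King-fibre fit = FILE 10's oscillation
`2(d+1)(L^m − 1)c₃₅α₀∕(L^mL^k) ≤ 2(d+1)c₃₅α₀L^{−k}` from the first quotients; part XVII's `(d+1)(Ω + r∕L^k)`); ★ `c2AvgSpecies_hF` — part XIII `siteLettersF_of_speciesLetters`'s binder `hF`
VERBATIM on any index map into the family and any size assignment (`r₀ = o₀ = K_av`, `a₂ = 1`).  §2: defs `c2SitePertFF ∕ c2SitePertFC` (part VI's `sitePert365F` words of THE massless scalar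
site propagator at part X's first-order species AND §1's averaging species; `_eq`), ★★ `siteLettersF_c2Bg` — part II∕IV's three site letters (`hP`) for them on the sub-index `m ≥ 1`
= part XIII §1 `siteLettersF_of_speciesLetters` FULLY INHABITED (`hV` := part X §2, `hF` := §1): genuine perturbation-matrix estimates, uniform in the index.
DELIBERATELY NOT HERE: the `N15At` knit of these perturbations on this family (typed rc 0 in the seat's folder) — see the vacuity note below; the knit with content is the SIZED
one (parts XVIII∕XIX on FILE 40's family).

HONEST FRAMING.  Count-neutral helper; elementary bookkeeping over DISPLAYED letters; MODEL-LEVEL exactly as parts X ∕ XVII (abelianised linearised contour kernel read off the bond coefficient,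
plain block mean, King's pairing).  The family's torus instances have size field `M ≡ 1`, so an `NE2PlusOperator ∕ NE2PlusSite` conclusion over them is trivially inhabited as typed
(ref-F FLAG-VACUITY-A1 ∕ plan g82: the cure is the SIZED road, part XVII §2 and its sequel) — THIS FILE states LETTERS (genuine `HasMaj` facts), not such a conclusion.  NE2⁺ NOT
PRINTED ∕ NOT proved; **N15 is NOT discharged** (typed 28∕28 · discharged 5∕27 of record unchanged); K3⁷ OPEN, its N15 pin untouched; one finite four-torus programme at fixed `ε` —
NOT ℝ⁴, NOT infinite volume, NOT OS, NOT a mass gap, NOT Clay; R4 closes the conditional finite-𝕋⁴ rung `BalabanLadder.UV` only.  Restate-immune.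
-/

set_option autoImplicit false

noncomputable section

open scoped BigOperators
open Finset

namespace Summit.QuantumFields.YangMills.BalabanUVNodes.N15.SiteLayerBg

open Literature.MathematicalPhysics.QuantumFieldTheory.Balaban1983to89
open Literature.MathematicalPhysics.QuantumFieldTheory.Balaban1983to89.B11SectG (BlockNorm HasMaj)
open Literature.MathematicalPhysics.QuantumFieldTheory.Balaban1983to89.T4EtaRateDefect (idef)
open Literature.MathematicalPhysics.QuantumFieldTheory.Balaban1983to89.T4EtaRateCoeffDefect (pull diagK diagK_mono fibre blockAvg FibreOsc fit_blockAvg)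
open Literature.MathematicalPhysics.QuantumFieldTheory.Balaban1983to89.B5Prop11Plancherel (Tor fine)
open Literature.MathematicalPhysics.QuantumFieldTheory.Balaban1983to89.B6UnitTorusCarrier (unitTorusGeo)
open Literature.MathematicalPhysics.QuantumFieldTheory.King1986.Torus (blockOf)
open Literature.MathematicalPhysics.QuantumFieldTheory.Balaban1983to89.B4Sect5Torus (tdist)
open Literature.MathematicalPhysics.QuantumFieldTheory.Balaban1983to89.B5QGGQ145Bounds (Idx)
open Summit.QuantumFields.YangMills.BalabanUVNodes.N15.SiteLayer (dressedOp)
open Summit.QuantumFields.YangMills.BalabanUVNodes.N15.VectorPiece (unitTorusGeoS kingPr kingPrV bshiftEquiv)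
open Summit.QuantumFields.YangMills.BalabanUVNodes.N15.TwoGrid (TGIndex)
open Summit.QuantumFields.YangMills.BalabanUVNodes.N15.BackgroundLayer (avg₁ abs_blockAvg_le fgInstanceC2 fibreOsc_of_fgrad inv_pow_le_rate)
open Summit.QuantumFields.YangMills.BalabanUVNodes.N15.UnitLayerBg (pair_avg_eq)
open Summit.QuantumFields.YangMills.BalabanUVNodes.N15KingModelRung.Curved (kingGOp kingDOp underPtN)

variable {d : ℕ} {L : ℕ} [NeZero L]

/-! ## §1 The species of the primitive-carrier family and their six letters from `Reg335`; part XIII's `hF` -/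

section Family

variable (d)

/-- THE COARSE AVERAGING SPECIES OF THE FAMILY at index `(i, ν)`: §1's `F₂` for the bond coefficient `V.2` of a coarse coefficient pair, component `ν`. [cite: Balaban1985BackgroundPropagators, (3.58) p.402 (shape)] -/
def c2AvgFc (hL : Odd L ∧ 1 < L) (i : TGIndex × Fin (d + 1)) (V : (fgInstanceC2 d hL i).Bc.Cfg) :
    (Tor (fine (L ^ i.1.k) (TGIndex.Mn d hL i.1)) → ℝ) →ₗ[ℝ] (Tor (TGIndex.Mn d hL i.1) → ℝ) :=
  siteAvgFc L (TGIndex.Mn d hL i.1) i.1.k V.2 i.2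

/-- THE COARSE STARRED AVERAGING SPECIES OF THE FAMILY. [cite: Balaban1985BackgroundPropagators, (3.60) p.402 (shape)] -/
def c2AvgFsc (hL : Odd L ∧ 1 < L) (i : TGIndex × Fin (d + 1)) (V : (fgInstanceC2 d hL i).Bc.Cfg) :
    (Tor (TGIndex.Mn d hL i.1) → ℝ) →ₗ[ℝ] (Tor (fine (L ^ i.1.k) (TGIndex.Mn d hL i.1)) → ℝ) :=
  siteAvgFsc L (TGIndex.Mn d hL i.1) i.1.k V.2 i.2

/-- THE FINE AVERAGING SPECIES OF THE FAMILY (bond coefficient `U.2` of the fine pair). [cite: Balaban1985BackgroundPropagators, (3.58) p.402 (shape)] -/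
def c2AvgFf (hL : Odd L ∧ 1 < L) (i : TGIndex × Fin (d + 1)) (U : (fgInstanceC2 d hL i).Bf.Cfg) :
    (Tor (fine (L ^ i.1.m * L ^ i.1.k) (TGIndex.Mn d hL i.1)) → ℝ) →ₗ[ℝ] (Tor (TGIndex.Mn d hL i.1) → ℝ) :=
  siteAvgFf L (TGIndex.Mn d hL i.1) i.1.k i.1.m U.2 i.2

/-- THE FINE STARRED AVERAGING SPECIES OF THE FAMILY. [cite: Balaban1985BackgroundPropagators, (3.60) p.402 (shape)] -/
def c2AvgFsf (hL : Odd L ∧ 1 < L) (i : TGIndex × Fin (d + 1)) (U : (fgInstanceC2 d hL i).Bf.Cfg) :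
    (Tor (TGIndex.Mn d hL i.1) → ℝ) →ₗ[ℝ] (Tor (fine (L ^ i.1.m * L ^ i.1.k) (TGIndex.Mn d hL i.1)) → ℝ) :=
  siteAvgFsf L (TGIndex.Mn d hL i.1) i.1.k i.1.m U.2 i.2

variable {d}

/-- Unfolding (coarse). [folklore] -/
theorem c2AvgFc_eq (hL : Odd L ∧ 1 < L) (i : TGIndex × Fin (d + 1)) (V : (fgInstanceC2 d hL i).Bc.Cfg) :
    c2AvgFc d hL i V = siteAvgFc L (TGIndex.Mn d hL i.1) i.1.k V.2 i.2 := rfl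

/-- Unfolding (coarse, starred). [folklore] -/
theorem c2AvgFsc_eq (hL : Odd L ∧ 1 < L) (i : TGIndex × Fin (d + 1)) (V : (fgInstanceC2 d hL i).Bc.Cfg) :
    c2AvgFsc d hL i V = siteAvgFsc L (TGIndex.Mn d hL i.1) i.1.k V.2 i.2 := rfl

/-- Unfolding (fine). [folklore] -/
theorem c2AvgFf_eq (hL : Odd L ∧ 1 < L) (i : TGIndex × Fin (d + 1)) (U : (fgInstanceC2 d hL i).Bf.Cfg) :
    c2AvgFf d hL i U = siteAvgFf L (TGIndex.Mn d hL i.1) i.1.k i.1.m U.2 i.2 := rfl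

/-- Unfolding (fine, starred). [folklore] -/
theorem c2AvgFsf_eq (hL : Odd L ∧ 1 < L) (i : TGIndex × Fin (d + 1)) (U : (fgInstanceC2 d hL i).Bf.Cfg) :
    c2AvgFsf d hL i U = siteAvgFsf L (TGIndex.Mn d hL i.1) i.1.k i.1.m U.2 i.2 := rfl

/-- THE AVERAGING-SPECIES CONSTANT `K_av = (d+1)(2d+3)·c₃₅ ≥ 0` for `c₃₅ ≥ 0`. [folklore] -/
theorem kav_nonneg {c35 : ℝ} (hc35 : 0 ≤ c35) : 0 ≤ ((d : ℝ) + 1) * (2 * (d : ℝ) + 3) * c35 := by positivity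

/-- ★★ **THE SIX LETTERS OF THE FAMILY's AVERAGING SPECIES FROM `Reg335`** at every index `(i, ν)` of dag-n15-c's primitive-carrier family, every `γ ≤ 2`, every size `M_sz`: for
`α₀ > 0` and `U` regular at level `c₃₅ ≥ 0` — sup letters `≤ diagK (K_av α₀)` for `F₂(Ū), F₂*(Ū), F₂′(U), F₂*′(U)` (a bond coefficient and its block mean are `≤ c₃₅α₀`, a
contour carries `(d+1)` of them) and fits `𝔇(F₂′(U), F₂(Ū)), 𝔇(F₂*′(U), F₂*(Ū)) ≤ diagK (K_av α₀ (L^k)^{−γ∕2})` (the coefficient minus its King block mean is within the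
fibre oscillation `2(d+1)(L^m − 1)c₃₅α₀∕(L^mL^k) ≤ 2(d+1)c₃₅α₀L^{−k}`, FILE 10 `fibreOsc_of_fgrad` + `fit_blockAvg`; §1's fit then reads `(d+1)(2(d+1) + 1)c₃₅α₀L^{−k}`, and
`L^{−k} ≤ (L^k)^{−γ∕2}`).  `K_av = (d+1)(2d+3)c₃₅`. [cite: Balaban1985BackgroundPropagators, (3.35) p.396 (the letters, shape), (3.58) p.402 (shape); King1986, p.664 (pairing)] -/
theorem c2AvgSpecies_letters (hL : Odd L ∧ 1 < L) {c35 : ℝ} (hc35 : 0 ≤ c35) {γ : ℝ} (hγ2 : γ ≤ 2) (i : TGIndex × Fin (d + 1)) (Msz : ℝ) {α₀ : ℝ} (hα₀ : 0 < α₀)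
    (U : (fgInstanceC2 d hL i).Bf.Cfg) (hU : (fgInstanceC2 d hL i).Bf.Reg335 c35 α₀ U) :
    HasMaj (BlockNorm.ofBlocks (unitTorusGeoS L i.1.k (TGIndex.Mn d hL i.1) Msz) (blockOf (L ^ i.1.k) (TGIndex.Mn d hL i.1)))
        (BlockNorm.ofBlocks (unitTorusGeoS L i.1.k (TGIndex.Mn d hL i.1) Msz) (fun y : Tor (TGIndex.Mn d hL i.1) => y))
        (c2AvgFc d hL i ((fgInstanceC2 d hL i).pair.avg U)) (diagK fun _ => ((d : ℝ) + 1) * (2 * (d : ℝ) + 3) * c35 * α₀) ∧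
      HasMaj (BlockNorm.ofBlocks (unitTorusGeoS L i.1.k (TGIndex.Mn d hL i.1) Msz) (fun y : Tor (TGIndex.Mn d hL i.1) => y))
        (BlockNorm.ofBlocks (unitTorusGeoS L i.1.k (TGIndex.Mn d hL i.1) Msz) (blockOf (L ^ i.1.k) (TGIndex.Mn d hL i.1)))
        (c2AvgFsc d hL i ((fgInstanceC2 d hL i).pair.avg U)) (diagK fun _ => ((d : ℝ) + 1) * (2 * (d : ℝ) + 3) * c35 * α₀) ∧
      HasMaj (BlockNorm.ofBlocks (unitTorusGeoS L i.1.k (TGIndex.Mn d hL i.1) Msz) (blockOf (L ^ i.1.k) (TGIndex.Mn d hL i.1) ∘ underPtN L i.1.k i.1.m (TGIndex.Mn d hL i.1)))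
        (BlockNorm.ofBlocks (unitTorusGeoS L i.1.k (TGIndex.Mn d hL i.1) Msz) (fun y : Tor (TGIndex.Mn d hL i.1) => y))
        (c2AvgFf d hL i U) (diagK fun _ => ((d : ℝ) + 1) * (2 * (d : ℝ) + 3) * c35 * α₀) ∧
      HasMaj (BlockNorm.ofBlocks (unitTorusGeoS L i.1.k (TGIndex.Mn d hL i.1) Msz) (fun y : Tor (TGIndex.Mn d hL i.1) => y))
        (BlockNorm.ofBlocks (unitTorusGeoS L i.1.k (TGIndex.Mn d hL i.1) Msz) (blockOf (L ^ i.1.k) (TGIndex.Mn d hL i.1) ∘ underPtN L i.1.k i.1.m (TGIndex.Mn d hL i.1)))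
        (c2AvgFsf d hL i U) (diagK fun _ => ((d : ℝ) + 1) * (2 * (d : ℝ) + 3) * c35 * α₀) ∧
      HasMaj (BlockNorm.ofBlocks (unitTorusGeoS L i.1.k (TGIndex.Mn d hL i.1) Msz) (blockOf (L ^ i.1.k) (TGIndex.Mn d hL i.1)))
        (BlockNorm.ofBlocks (unitTorusGeoS L i.1.k (TGIndex.Mn d hL i.1) Msz) (fun y : Tor (TGIndex.Mn d hL i.1) => y))
        (idef (pull (underPtN L i.1.k i.1.m (TGIndex.Mn d hL i.1))) LinearMap.id (c2AvgFf d hL i U) (c2AvgFc d hL i ((fgInstanceC2 d hL i).pair.avg U)))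
        (diagK fun _ => ((d : ℝ) + 1) * (2 * (d : ℝ) + 3) * c35 * α₀ * ((L : ℝ) ^ i.1.k) ^ (-(γ / 2))) ∧
      HasMaj (BlockNorm.ofBlocks (unitTorusGeoS L i.1.k (TGIndex.Mn d hL i.1) Msz) (fun y : Tor (TGIndex.Mn d hL i.1) => y))
        (BlockNorm.ofBlocks (unitTorusGeoS L i.1.k (TGIndex.Mn d hL i.1) Msz) (blockOf (L ^ i.1.k) (TGIndex.Mn d hL i.1) ∘ underPtN L i.1.k i.1.m (TGIndex.Mn d hL i.1)))
        (idef LinearMap.id (pull (underPtN L i.1.k i.1.m (TGIndex.Mn d hL i.1))) (c2AvgFsf d hL i U) (c2AvgFsc d hL i ((fgInstanceC2 d hL i).pair.avg U)))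
        (diagK fun _ => ((d : ℝ) + 1) * (2 * (d : ℝ) + 3) * c35 * α₀ * ((L : ℝ) ^ i.1.k) ^ (-(γ / 2))) := by
  obtain ⟨⟨-, hB0⟩, ⟨-, hC20⟩, -⟩ := hU
  have hM1 : c35 * (unitTorusGeo L i.1.k (TGIndex.Mn d hL i.1)).M * α₀ = c35 * α₀ := by
    rw [show (unitTorusGeo L i.1.k (TGIndex.Mn d hL i.1)).M = 1 from rfl, mul_one]
  have hB : ∀ μ x', |U.2 μ x'| ≤ c35 * α₀ := fun μ x' => (hB0 μ x').trans_eq hM1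
  have hC2 : ∀ μ κ x', |BackgroundLayer.fgrad ((L ^ i.1.m * L ^ i.1.k : ℕ) : ℝ) (bshiftEquiv (TGIndex.Mn d hL i.1) (L ^ i.1.m * L ^ i.1.k) κ) (U.2 μ) x'| ≤ c35 * α₀ :=
    fun μ κ x' => (hC20 μ κ x').trans_eq hM1
  set M := TGIndex.Mn d hL i.1 with hMdef
  set k := i.1.k with hkdef
  set m := i.1.m with hmdef
  set ν := i.2 with hνdef
  have hL0 : 0 < L := Nat.pos_of_ne_zero (NeZero.ne L)
  have hL1 : (1 : ℝ) ≤ (L : ℝ) := by exact_mod_cast hL0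
  have hr : 0 ≤ c35 * α₀ := mul_nonneg hc35 hα₀.le
  have hd0 : (0 : ℝ) ≤ d := Nat.cast_nonneg d
  have hθ : 0 ≤ ((L : ℝ) ^ k) ^ (-(γ / 2)) := Real.rpow_nonneg (pow_nonneg (Nat.cast_nonneg _) _) _
  have hLk : (0 : ℝ) < ((L ^ k : ℕ) : ℝ) := by positivity
  -- the coarse coefficient is the King block mean of the fine one
  rw [pair_avg_eq]
  have hBbar : ∀ μ b, |(avg₁ (Fin (d + 1)) (kingPrV L k m M) U).2 μ b| ≤ c35 * α₀ := fun μ b => abs_blockAvg_le _ hr (hB μ) _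
  -- the pointwise fit through King's pairing: within the fibre oscillation
  have hn' : (0 : ℝ) < ((L ^ m * L ^ k : ℕ) : ℝ) := by positivity
  have hosc : ∀ μ, FibreOsc (kingPrV L k m M) (U.2 μ) (fun _ => ((2 * ((d + 1) * (L ^ m - 1)) : ℕ) : ℝ) * (c35 * α₀ / ((L ^ m * L ^ k : ℕ) : ℝ))) :=
    fun μ => fibreOsc_of_fgrad L k m M hn' (hC2 μ)
  set Ω : ℝ := ((2 * ((d + 1) * (L ^ m - 1)) : ℕ) : ℝ) * (c35 * α₀ / ((L ^ m * L ^ k : ℕ) : ℝ)) with hΩdef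
  have hΩ0 : 0 ≤ Ω := by positivity
  have hfit : ∀ μ b', |U.2 μ b' - (avg₁ (Fin (d + 1)) (kingPrV L k m M) U).2 μ (kingPrV L k m M b')| ≤ Ω := fun μ b' =>
    fit_blockAvg (kingPrV L k m M) (hosc μ) b'
  -- the oscillation bound `Ω ≤ 2(d+1)c₃₅α₀·L^{−k}`
  have hΩle : Ω ≤ 2 * ((d : ℝ) + 1) * (c35 * α₀) * (((L ^ k : ℕ) : ℝ))⁻¹ := by
    have hLm : (0 : ℝ) < ((L ^ m : ℕ) : ℝ) := by positivity
    have h1 : ((2 * ((d + 1) * (L ^ m - 1)) : ℕ) : ℝ) ≤ 2 * ((d : ℝ) + 1) * ((L ^ m : ℕ) : ℝ) := by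
      have : ((L ^ m - 1 : ℕ) : ℝ) ≤ ((L ^ m : ℕ) : ℝ) := by exact_mod_cast Nat.sub_le _ _
      push_cast [Nat.cast_sub (Nat.one_le_pow _ _ hL0)] at this ⊢
      nlinarith
    calc Ω ≤ 2 * ((d : ℝ) + 1) * ((L ^ m : ℕ) : ℝ) * (c35 * α₀ / ((L ^ m * L ^ k : ℕ) : ℝ)) := mul_le_mul_of_nonneg_right h1 (by positivity)
      _ = 2 * ((d : ℝ) + 1) * (c35 * α₀) * (((L ^ k : ℕ) : ℝ))⁻¹ := by
          have : ((L ^ m * L ^ k : ℕ) : ℝ) = ((L ^ m : ℕ) : ℝ) * ((L ^ k : ℕ) : ℝ) := by push_cast; ring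
          rw [this]; field_simp
  -- §1's six letters at `r = c₃₅α₀`, `Ω`
  obtain ⟨h1, h2, h3, h4, h5, h6⟩ := siteAvgSpecies_letters L M k m Msz (a' := U.2) (a := (avg₁ (Fin (d + 1)) (kingPrV L k m M) U).2) hr hΩ0 hB hBbar hfit ν
  -- constants: `(d+1)c₃₅α₀ ≤ K_av α₀`, `(d+1)(Ω + c₃₅α₀∕L^k) ≤ K_av α₀ (L^k)^{−γ/2}`
  have hsize : ((d : ℝ) + 1) * (c35 * α₀) ≤ ((d : ℝ) + 1) * (2 * (d : ℝ) + 3) * c35 * α₀ := by nlinarith [mul_nonneg hd0 hr]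
  have hrate : (((L ^ k : ℕ) : ℝ))⁻¹ ≤ ((L : ℝ) ^ k) ^ (-(γ / 2)) := inv_pow_le_rate (L := L) hL1 (by linarith)
  have hfitc : ((d : ℝ) + 1) * (Ω + (((L ^ k : ℕ) : ℝ))⁻¹ * (c35 * α₀)) ≤ ((d : ℝ) + 1) * (2 * (d : ℝ) + 3) * c35 * α₀ * ((L : ℝ) ^ k) ^ (-(γ / 2)) := by
    have h1 : Ω + (((L ^ k : ℕ) : ℝ))⁻¹ * (c35 * α₀) ≤ (2 * ((d : ℝ) + 1) + 1) * (c35 * α₀) * (((L ^ k : ℕ) : ℝ))⁻¹ := by nlinarith [hΩle]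
    have h2 : (2 * ((d : ℝ) + 1) + 1) * (c35 * α₀) * (((L ^ k : ℕ) : ℝ))⁻¹ ≤ (2 * ((d : ℝ) + 1) + 1) * (c35 * α₀) * ((L : ℝ) ^ k) ^ (-(γ / 2)) :=
      mul_le_mul_of_nonneg_left hrate (by positivity)
    calc ((d : ℝ) + 1) * (Ω + (((L ^ k : ℕ) : ℝ))⁻¹ * (c35 * α₀)) ≤ ((d : ℝ) + 1) * ((2 * ((d : ℝ) + 1) + 1) * (c35 * α₀) * ((L : ℝ) ^ k) ^ (-(γ / 2))) :=
          mul_le_mul_of_nonneg_left (h1.trans h2) (by positivity)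
      _ = ((d : ℝ) + 1) * (2 * (d : ℝ) + 3) * c35 * α₀ * ((L : ℝ) ^ k) ^ (-(γ / 2)) := by ring
  exact ⟨h1.mono fun y y' => diagK_mono (fun _ => hsize) y y', h2.mono fun y y' => diagK_mono (fun _ => hsize) y y',
    h3.mono fun y y' => diagK_mono (fun _ => hsize) y y', h4.mono fun y y' => diagK_mono (fun _ => hsize) y y',
    h5.mono fun y y' => diagK_mono (fun _ => hfitc) y y', h6.mono fun y y' => diagK_mono (fun _ => hfitc) y y'⟩

/-- ★ **PART XIII's AVERAGING-SPECIES BINDER `hF`, DISCHARGED FOR THE FAMILY** on any index map `e : J → TGIndex × Fin (d+1)` and any size assignment: `r₀ = o₀ = K_av`, `a₂ = 1`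
(for `α₀ ≤ 1` the fit `K_av α₀ θ ≤ K_av θ`); `0 < γ ≤ 2`, `c₃₅ ≥ 0`. [cite: Balaban1985BackgroundPropagators, (3.58) p.402 (shape); King1986, p.664] -/
theorem c2AvgSpecies_hF (hL : Odd L ∧ 1 < L) {c35 : ℝ} (hc35 : 0 ≤ c35) {γ : ℝ} (hγ2 : γ ≤ 2) {J : Type} (e : J → TGIndex × Fin (d + 1)) (Msz : J → ℝ) :
    ∃ r₀ o₀ a₂ : ℝ, 0 ≤ r₀ ∧ 0 ≤ o₀ ∧ 0 < a₂ ∧ ∀ (j : J) (α₀ : ℝ), 0 < α₀ → α₀ ≤ a₂ →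
      ∀ U : (fgInstanceC2 d hL (e j)).Bf.Cfg, (fgInstanceC2 d hL (e j)).Bf.Reg335 c35 α₀ U →
      HasMaj (BlockNorm.ofBlocks (unitTorusGeoS L (e j).1.k (TGIndex.Mn d hL (e j).1) (Msz j)) (blockOf (L ^ (e j).1.k) (TGIndex.Mn d hL (e j).1)))
          (BlockNorm.ofBlocks (unitTorusGeoS L (e j).1.k (TGIndex.Mn d hL (e j).1) (Msz j)) (fun y : Tor (TGIndex.Mn d hL (e j).1) => y))
          (c2AvgFc d hL (e j) ((fgInstanceC2 d hL (e j)).pair.avg U)) (diagK fun _ => r₀ * α₀) ∧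
        HasMaj (BlockNorm.ofBlocks (unitTorusGeoS L (e j).1.k (TGIndex.Mn d hL (e j).1) (Msz j)) (fun y : Tor (TGIndex.Mn d hL (e j).1) => y))
          (BlockNorm.ofBlocks (unitTorusGeoS L (e j).1.k (TGIndex.Mn d hL (e j).1) (Msz j)) (blockOf (L ^ (e j).1.k) (TGIndex.Mn d hL (e j).1)))
          (c2AvgFsc d hL (e j) ((fgInstanceC2 d hL (e j)).pair.avg U)) (diagK fun _ => r₀ * α₀) ∧
        HasMaj (BlockNorm.ofBlocks (unitTorusGeoS L (e j).1.k (TGIndex.Mn d hL (e j).1) (Msz j))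
            (blockOf (L ^ (e j).1.k) (TGIndex.Mn d hL (e j).1) ∘ underPtN L (e j).1.k (e j).1.m (TGIndex.Mn d hL (e j).1)))
          (BlockNorm.ofBlocks (unitTorusGeoS L (e j).1.k (TGIndex.Mn d hL (e j).1) (Msz j)) (fun y : Tor (TGIndex.Mn d hL (e j).1) => y))
          (c2AvgFf d hL (e j) U) (diagK fun _ => r₀ * α₀) ∧
        HasMaj (BlockNorm.ofBlocks (unitTorusGeoS L (e j).1.k (TGIndex.Mn d hL (e j).1) (Msz j)) (fun y : Tor (TGIndex.Mn d hL (e j).1) => y))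
          (BlockNorm.ofBlocks (unitTorusGeoS L (e j).1.k (TGIndex.Mn d hL (e j).1) (Msz j))
            (blockOf (L ^ (e j).1.k) (TGIndex.Mn d hL (e j).1) ∘ underPtN L (e j).1.k (e j).1.m (TGIndex.Mn d hL (e j).1)))
          (c2AvgFsf d hL (e j) U) (diagK fun _ => r₀ * α₀) ∧
        HasMaj (BlockNorm.ofBlocks (unitTorusGeoS L (e j).1.k (TGIndex.Mn d hL (e j).1) (Msz j)) (blockOf (L ^ (e j).1.k) (TGIndex.Mn d hL (e j).1)))
          (BlockNorm.ofBlocks (unitTorusGeoS L (e j).1.k (TGIndex.Mn d hL (e j).1) (Msz j)) (fun y : Tor (TGIndex.Mn d hL (e j).1) => y))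
          (idef (pull (underPtN L (e j).1.k (e j).1.m (TGIndex.Mn d hL (e j).1))) LinearMap.id (c2AvgFf d hL (e j) U)
            (c2AvgFc d hL (e j) ((fgInstanceC2 d hL (e j)).pair.avg U)))
          (diagK fun _ => o₀ * ((L : ℝ) ^ (e j).1.k) ^ (-(γ / 2))) ∧
        HasMaj (BlockNorm.ofBlocks (unitTorusGeoS L (e j).1.k (TGIndex.Mn d hL (e j).1) (Msz j)) (fun y : Tor (TGIndex.Mn d hL (e j).1) => y))
          (BlockNorm.ofBlocks (unitTorusGeoS L (e j).1.k (TGIndex.Mn d hL (e j).1) (Msz j))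
            (blockOf (L ^ (e j).1.k) (TGIndex.Mn d hL (e j).1) ∘ underPtN L (e j).1.k (e j).1.m (TGIndex.Mn d hL (e j).1)))
          (idef LinearMap.id (pull (underPtN L (e j).1.k (e j).1.m (TGIndex.Mn d hL (e j).1))) (c2AvgFsf d hL (e j) U)
            (c2AvgFsc d hL (e j) ((fgInstanceC2 d hL (e j)).pair.avg U)))
          (diagK fun _ => o₀ * ((L : ℝ) ^ (e j).1.k) ^ (-(γ / 2))) := by
  refine ⟨((d : ℝ) + 1) * (2 * (d : ℝ) + 3) * c35, ((d : ℝ) + 1) * (2 * (d : ℝ) + 3) * c35, 1, kav_nonneg hc35, kav_nonneg hc35, one_pos,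
    fun j α₀ hα₀ hα1 U hU => ?_⟩
  obtain ⟨h1, h2, h3, h4, h5, h6⟩ := c2AvgSpecies_letters (d := d) hL hc35 hγ2 (e j) (Msz j) hα₀ U hU
  have hθ : 0 ≤ ((L : ℝ) ^ (e j).1.k) ^ (-(γ / 2)) := Real.rpow_nonneg (pow_nonneg (Nat.cast_nonneg _) _) _
  have hK := kav_nonneg (d := d) hc35
  have hfit : ((d : ℝ) + 1) * (2 * (d : ℝ) + 3) * c35 * α₀ * ((L : ℝ) ^ (e j).1.k) ^ (-(γ / 2)) ≤ ((d : ℝ) + 1) * (2 * (d : ℝ) + 3) * c35 * ((L : ℝ) ^ (e j).1.k) ^ (-(γ / 2)) := by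
    have : ((d : ℝ) + 1) * (2 * (d : ℝ) + 3) * c35 * α₀ ≤ ((d : ℝ) + 1) * (2 * (d : ℝ) + 3) * c35 := by nlinarith
    exact mul_le_mul_of_nonneg_right this hθ
  exact ⟨h1, h2, h3, h4, h5.mono fun y y' => diagK_mono (fun _ => hfit) y y', h6.mono fun y y' => diagK_mono (fun _ => hfit) y y'⟩

end Family


/-! ## §2 The family's (3.65) site perturbation matrices with the averaging species live, and their three site letters -/

section Pert

variable (d)

/-- THE FINE RUN's (3.65) SITE PERTURBATION MATRIX WITH THE AVERAGING SPECIES LIVE at index `(i, ν)` and configuration `U`: part VI's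
`siteEntries (sitePert365F (blockOf ∘ pr) F₂′(U) F₂*′(U) G′ X(U))`, `G′ = kingGOp L a_S 0 (k+m) (L^mL^k) M` THE massless scalar site propagator of the fine run, `X(U) = dressedOp G′ D V̂_f(U)` its
S4-dressing by part X's first-order species, `F₂′(U), F₂*′(U)` part XVII's averaging species. [cite: Balaban1985BackgroundPropagators, (3.58) p.402, (3.65) p.403 (shape)] -/
def c2SitePertFF (hL : Odd L ∧ 1 < L) (aS : ℝ) (i : TGIndex × Fin (d + 1)) (U : (fgInstanceC2 d hL i).Bf.Cfg) :
    Matrix (Idx (TGIndex.Mn d hL i.1)) (Idx (TGIndex.Mn d hL i.1)) ℝ :=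
  siteEntries (TGIndex.Mn d hL i.1) (sitePert365F (TGIndex.Mn d hL i.1) (blockOf (L ^ i.1.k) (TGIndex.Mn d hL i.1) ∘ underPtN L i.1.k i.1.m (TGIndex.Mn d hL i.1))
    (c2AvgFf d hL i U) (c2AvgFsf d hL i U) (kingGOp L aS 0 (i.1.k + i.1.m) (L ^ i.1.m * L ^ i.1.k) (TGIndex.Mn d hL i.1))
    (dressedOp (kingGOp L aS 0 (i.1.k + i.1.m) (L ^ i.1.m * L ^ i.1.k) (TGIndex.Mn d hL i.1)) (fun μ => kingDOp L aS 0 (i.1.k + i.1.m) (L ^ i.1.m * L ^ i.1.k) (TGIndex.Mn d hL i.1) μ)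
      (c2SiteSpeciesF d hL i U)))

/-- THE COARSE RUN's (3.65) SITE PERTURBATION MATRIX WITH THE AVERAGING SPECIES LIVE at `(i, ν)` and a coarse configuration `V` (`G′ = kingGOp L a_S 0 k (L^k) M`).
[cite: Balaban1985BackgroundPropagators, (3.58) p.402, (3.65) p.403 (shape)] -/
def c2SitePertFC (hL : Odd L ∧ 1 < L) (aS : ℝ) (i : TGIndex × Fin (d + 1)) (V : (fgInstanceC2 d hL i).Bc.Cfg) :
    Matrix (Idx (TGIndex.Mn d hL i.1)) (Idx (TGIndex.Mn d hL i.1)) ℝ :=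
  siteEntries (TGIndex.Mn d hL i.1) (sitePert365F (TGIndex.Mn d hL i.1) (blockOf (L ^ i.1.k) (TGIndex.Mn d hL i.1)) (c2AvgFc d hL i V) (c2AvgFsc d hL i V)
    (kingGOp L aS 0 i.1.k (L ^ i.1.k) (TGIndex.Mn d hL i.1))
    (dressedOp (kingGOp L aS 0 i.1.k (L ^ i.1.k) (TGIndex.Mn d hL i.1)) (fun μ => kingDOp L aS 0 i.1.k (L ^ i.1.k) (TGIndex.Mn d hL i.1) μ) (c2SiteSpeciesC d hL i V)))

variable {d}

/-- Unfolding (fine). [folklore] -/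
theorem c2SitePertFF_eq (hL : Odd L ∧ 1 < L) (aS : ℝ) (i : TGIndex × Fin (d + 1)) (U : (fgInstanceC2 d hL i).Bf.Cfg) :
    c2SitePertFF d hL aS i U = siteEntries (TGIndex.Mn d hL i.1) (sitePert365F (TGIndex.Mn d hL i.1) (blockOf (L ^ i.1.k) (TGIndex.Mn d hL i.1) ∘ underPtN L i.1.k i.1.m (TGIndex.Mn d hL i.1))
      (c2AvgFf d hL i U) (c2AvgFsf d hL i U) (kingGOp L aS 0 (i.1.k + i.1.m) (L ^ i.1.m * L ^ i.1.k) (TGIndex.Mn d hL i.1))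
      (dressedOp (kingGOp L aS 0 (i.1.k + i.1.m) (L ^ i.1.m * L ^ i.1.k) (TGIndex.Mn d hL i.1)) (fun μ => kingDOp L aS 0 (i.1.k + i.1.m) (L ^ i.1.m * L ^ i.1.k) (TGIndex.Mn d hL i.1) μ)
        (c2SiteSpeciesF d hL i U))) := rfl

/-- Unfolding (coarse). [folklore] -/
theorem c2SitePertFC_eq (hL : Odd L ∧ 1 < L) (aS : ℝ) (i : TGIndex × Fin (d + 1)) (V : (fgInstanceC2 d hL i).Bc.Cfg) :
    c2SitePertFC d hL aS i V = siteEntries (TGIndex.Mn d hL i.1) (sitePert365F (TGIndex.Mn d hL i.1) (blockOf (L ^ i.1.k) (TGIndex.Mn d hL i.1)) (c2AvgFc d hL i V) (c2AvgFsc d hL i V)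
      (kingGOp L aS 0 i.1.k (L ^ i.1.k) (TGIndex.Mn d hL i.1))
      (dressedOp (kingGOp L aS 0 i.1.k (L ^ i.1.k) (TGIndex.Mn d hL i.1)) (fun μ => kingDOp L aS 0 i.1.k (L ^ i.1.k) (TGIndex.Mn d hL i.1) μ) (c2SiteSpeciesC d hL i V))) := rfl

end Pert

section Letters

/-- ★★ **THE THREE SITE LETTERS OF THE FAMILY's (3.65) PERTURBATIONS WITH BOTH SPECIES LIVE** (part II∕IV's `hP`) on the sub-index `m ≥ 1`: part XIII §1 `siteLettersF_of_speciesLetters`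
fed by part X §2 (`hV`, the first-order species' three diagonal letters) and part XVII §2 (`hF`, the averaging species' six letters) — `U ≡ 1` layer = the genuine massless scalar site propagator
of the run; odd `L ≥ 3`, `a_S > 0`, `c₃₅ ≥ 0`, `0 < γ < 1`. [cite: Balaban1985BackgroundPropagators, (3.58) p.402, (3.63)–(3.67) pp.402–403 (mechanism), Thm 3.2 (3.48) p.398; King1986, Prop. 3.8 (3.71) p.664] -/
theorem siteLettersF_c2Bg (hLodd : Odd L) (hL2 : 2 ≤ L) (hL : Odd L ∧ 1 < L) {aS : ℝ} (haS : 0 < aS) {c35 : ℝ} (hc35 : 0 ≤ c35) {γ : ℝ} (hγ0 : 0 < γ) (hγ1 : γ < 1) :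
    ∃ δP ζ τ a₁ : ℝ, 0 < δP ∧ 0 < ζ ∧ 0 < τ ∧ 0 < a₁ ∧
      ∀ (j : FGIndexLM d) (α₀ : ℝ), 0 < α₀ → α₀ ≤ a₁ → ∀ U : (fgInstanceC2 d hL j.1.1).Bf.Cfg, (fgInstanceC2 d hL j.1.1).Bf.Reg335 c35 α₀ U →
        (∀ p p' : Idx (TGIndex.Mn d hL j.1.1.1), |c2SitePertFC d hL aS j.1.1 ((fgInstanceC2 d hL j.1.1).pair.avg U) p p'| ≤ ζ * α₀ * Real.exp (-(δP * tdist (TGIndex.Mn d hL j.1.1.1) p p'))) ∧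
        (∀ p p' : Idx (TGIndex.Mn d hL j.1.1.1), |c2SitePertFF d hL aS j.1.1 U p p'| ≤ ζ * α₀ * Real.exp (-(δP * tdist (TGIndex.Mn d hL j.1.1.1) p p'))) ∧
        (∀ p p' : Idx (TGIndex.Mn d hL j.1.1.1), |c2SitePertFF d hL aS j.1.1 U p p' - c2SitePertFC d hL aS j.1.1 ((fgInstanceC2 d hL j.1.1).pair.avg U) p p'|
            ≤ τ * ((L : ℝ) ^ j.1.1.1.k) ^ (-(γ / 2)) * Real.exp (-(δP * tdist (TGIndex.Mn d hL j.1.1.1) p p'))) :=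
  siteLettersF_of_speciesLetters (L := L) (fun j : FGIndexLM d => TGIndex.Mn d hL j.1.1.1) (fun j => j.1.1.1.k) (fun j => j.1.1.1.m) (fun _ => 1)
    (fun j => (fgInstanceC2 d hL j.1.1).Bc) (fun j => (fgInstanceC2 d hL j.1.1).Bf) (fun j => (fgInstanceC2 d hL j.1.1).pair.avg)
    (fun j => c2SiteSpeciesC d hL j.1.1) (fun j => c2SiteSpeciesF d hL j.1.1)
    (fun j => c2AvgFc d hL j.1.1) (fun j => c2AvgFsc d hL j.1.1) (fun j => c2AvgFf d hL j.1.1) (fun j => c2AvgFsf d hL j.1.1)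
    hLodd hL2 haS c35 hγ0 hγ1 (mT := fun j => j.1.1.1.mT) (fun _ _ => rfl) (fun j => j.1.1.1.one_le) (fun j => j.2)
    ⟨2 * ((d : ℝ) + 1) * ((d : ℝ) + 2) * c35, 1, ksp_nonneg hc35, one_pos, fun j α₀ hα₀ _ U hU => c2SiteSpecies_letters (d := d) hL hc35 (by linarith) j.1.1 1 hα₀ U hU⟩
    (c2AvgSpecies_hF (d := d) hL hc35 (by linarith) (fun j : FGIndexLM d => j.1.1) (fun _ => 1))

end Letters


end Summit.QuantumFields.YangMills.BalabanUVNodes.N15.SiteLayerBg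

end
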